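import Summits.CriticalPhenomena.PercolationContinuityZ3.Theorems.PercNearOneGluingNoHeavyLowerTailSahiE3JuntaMeetBlock
import Summits.CriticalPhenomena.PercolationContinuityZ3.Theorems.PercNearOneGluingNoHeavyLowerTailSahiE3BlockEventDefs
import Summits.CriticalPhenomena.PercolationContinuityZ3.Theorems.PercNearOneGluingNoHeavyLowerTailSahiC3CubeAnyIndex
import Literature.Probability.Percolation.ProdBernoulliRusso
import Mathlib.Tactic.Linarith
import Mathlib.Tactic.Ring
import HarnessLib

/-!
# `NoHeavyLowerTail` (crux stmt-CriticalPhenomena-4575), Sahi programme P4: Sahi's `E₃ ≥ 0` in EVERY dimension whenever a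
# pairwise intersection depends on at most three coordinates — UNCONDITIONALLY (kernel axioms); `≤ 4` in `…SahiE3JuntaMeetSmallFour`

Support file (cell `prim-l12`, seat P4, generation 3; `--supports stmt-CriticalPhenomena-4575`).  No named facts, no sorries, no
definitions (the two bookkeeping definitions `liftCfg`, `blockEvent` live in `…SahiE3BlockEventDefs`).  Composes the transfer theorem
`SahiE3JuntaMeet.sahiE3_nonneg_of_mul_junta_of_block` ("Sahi's inequality is local in the intersection", `…SahiE3JuntaMeetBlock`) with
the Sahi cell's cube theorem `SahiC3Cube.sahiC3_of_card_le_three` (kernel `decide`) through a bridge between the finitary weighted cube (`ED`, configurations `S ⊆ W : Finset ι`, real weights) and the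
product measure `prodBernoulli` on `Set ↥W` (`RussoPath.prodBernoulli_real_eq_sum_powerset`).

* `ED_eq_prodBernoulli_real` — for a `{0,1}`-valued `φ` on configurations, `E_W φ = (prodBernoulli q)(blockEvent W φ)` with
  `q = p|_W`;  `ED_sahiE3_eq` — the `ED`-form of `E₃(t,f,g)` on the block equals `sahiE3 (prodBernoulli q)` of the three block events.
* `ED_sahiE3_nonneg_of_card_le_three` — Sahi's inequality in `ED` form on every block of `≤ 3` coordinates.
* **`sahiE3_nonneg_of_mul_junta_card_le_three`** — on ANY weighted cube `W ∪ D` (`p ∈ [0,1]`), for all monotone `{0,1}`-valued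
  `u, f, g` (up-sets `U, A, B`) such that `A ∩ B` is determined by a block `W` of at most three coordinates: `E₃(u,f,g) ≥ 0`
  (axioms `propext`, `Classical.choice`, `Quot.sound` only; the `≤ 4` version, resting on the `native_decide` certificate
  `…SahiC3CubeFour`, is in the companion file `…SahiE3JuntaMeetSmallFour`).  A new unconditional class of Kahn's Conjecture 5 / Sahi's `C₃` (the principal-intersection class of
  `…SahiE3PrincipalMeet` has no size restriction; here the intersection is an arbitrary up-set of a small block).  [this work]
-/

noncomputable section

open Classical

namespace Summit.CriticalPhenomena.PercolationContinuityZ3.Theorems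

namespace SahiE3JuntaMeet

open Finset MeasureTheory Literature.Probability.Percolation Literature.Probability.Percolation.DecisionTree
  Literature.Probability.LatticeModels SahiE3PrincipalMeet

variable {ι : Type*}

/-- **The bridge**: the weighted-cube expectation of a `{0,1}`-valued `φ` over the block `W` (weights `p ∈ [0,1]`) is the
`prodBernoulli` probability of its block event, for the block weights `q i = p i`. [folklore; via
`RussoPath.prodBernoulli_real_eq_sum_powerset`] -/
theorem ED_eq_prodBernoulli_real [DecidableEq ι] (W : Finset ι) {p : ι → ℝ} (hp0 : ∀ i, 0 ≤ p i) (hp1 : ∀ i, p i ≤ 1)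
    {φ : Finset ι → ℝ} (hφ01 : ∀ S, φ S = 0 ∨ φ S = 1) :
    ED W p φ = (prodBernoulli fun i : ↥W => (⟨p i, hp0 i, hp1 i⟩ : unitInterval)).real (blockEvent W φ) := by
  have hdet : DeterminedBy (blockEvent W φ) (↑(Finset.univ : Finset ↥W) : Set ↥W) := by
    rw [Finset.coe_univ, determinedBy_iff]
    intro ω ω' h
    rw [Set.inter_univ, Set.inter_univ] at h
    rw [h]
  rw [RussoPath.prodBernoulli_real_eq_sum_powerset hdet]
  unfold ED
  symm
  refine Finset.sum_nbij' (fun S' => S'.map (Function.Embedding.subtype _)) (fun S => S.subtype (· ∈ W)) ?_ ?_ ?_ ?_ ?_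
  · intro S' _
    exact Finset.mem_powerset.2 fun j hj => by
      obtain ⟨x, _, rfl⟩ := Finset.mem_map.1 hj
      exact x.2
  · intro S _
    exact Finset.mem_powerset.2 (Finset.subset_univ _)
  · intro S' _
    ext x
    simp only [Finset.mem_subtype, Finset.mem_map, Function.Embedding.coe_subtype]
    constructor
    · rintro ⟨y, hy, hyx⟩
      rwa [← Subtype.ext hyx]
    · intro hx
      exact ⟨x, hx, rfl⟩
  · intro S hS
    exact Finset.subtype_map_of_mem fun x hx => Finset.mem_powerset.1 hS hx
  · intro S' _
    have hmem : (↑S' : Set ↥W) ∈ blockEvent W φ ↔ φ (S'.map (Function.Embedding.subtype _)) = 1 := by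
      rw [mem_blockEvent, liftCfg_coe]
    have hwt : (∏ i ∈ (Finset.univ : Finset ↥W),
          (if i ∈ S' then (((⟨p i, hp0 i, hp1 i⟩ : unitInterval) : ℝ)) else 1 - ((⟨p i, hp0 i, hp1 i⟩ : unitInterval) : ℝ)))
        = wtW W p (S'.map (Function.Embedding.subtype _)) := by
      unfold wtW
      rw [← Finset.prod_coe_sort W]
      refine Finset.prod_congr rfl fun i _ => ?_
      have hi : ((i : ι) ∈ S'.map (Function.Embedding.subtype _)) ↔ i ∈ S' := by
        simp only [Finset.mem_map, Function.Embedding.coe_subtype]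
        constructor
        · rintro ⟨y, hy, hyx⟩
          rwa [← Subtype.ext hyx]
        · intro h
          exact ⟨i, h, rfl⟩
      by_cases h : i ∈ S'
      · rw [if_pos h, if_pos (hi.2 h)]
      · rw [if_neg h, if_neg (fun h' => h (hi.1 h'))]
    by_cases h : (↑S' : Set ↥W) ∈ blockEvent W φ
    · rw [if_pos h, hwt, hmem.1 h, mul_one]
    · rw [if_neg h]
      rcases hφ01 (S'.map (Function.Embedding.subtype _)) with h0 | h1
      · rw [h0, mul_zero]
      · exact absurd (hmem.2 h1) h

/-- The `ED`-form of `E₃` on the block equals Sahi's `sahiE3` of the three block events under `prodBernoulli`. [this work] -/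
theorem ED_sahiE3_eq [DecidableEq ι] (W : Finset ι) {p : ι → ℝ} (hp0 : ∀ i, 0 ≤ p i) (hp1 : ∀ i, p i ≤ 1)
    {t f g : Finset ι → ℝ} (ht01 : ∀ S, t S = 0 ∨ t S = 1) (hf01 : ∀ S, f S = 0 ∨ f S = 1) (hg01 : ∀ S, g S = 0 ∨ g S = 1) :
    2 * ED W p (fun S => t S * f S * g S) + ED W p t * ED W p f * ED W p g - ED W p t * ED W p (fun S => f S * g S)
        - ED W p f * ED W p (fun S => t S * g S) - ED W p g * ED W p (fun S => t S * f S)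
      = sahiE3 (prodBernoulli fun i : ↥W => (⟨p i, hp0 i, hp1 i⟩ : unitInterval))
          (blockEvent W t) (blockEvent W f) (blockEvent W g) := by
  have h01 : ∀ {φ ψ : Finset ι → ℝ}, (∀ S, φ S = 0 ∨ φ S = 1) → (∀ S, ψ S = 0 ∨ ψ S = 1) →
      ∀ S, φ S * ψ S = 0 ∨ φ S * ψ S = 1 := by
    intro φ ψ hφ hψ S
    rcases hφ S with h | h <;> rcases hψ S with h' | h' <;> norm_num [h, h']
  rw [sahiE3_def, blockEvent_inter W ht01 hf01, blockEvent_inter W (h01 ht01 hf01) hg01, blockEvent_inter W hf01 hg01,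
    blockEvent_inter W ht01 hg01,
    ← ED_eq_prodBernoulli_real W hp0 hp1 (h01 (h01 ht01 hf01) hg01), ← ED_eq_prodBernoulli_real W hp0 hp1 ht01,
    ← ED_eq_prodBernoulli_real W hp0 hp1 hf01, ← ED_eq_prodBernoulli_real W hp0 hp1 hg01,
    ← ED_eq_prodBernoulli_real W hp0 hp1 (h01 hf01 hg01), ← ED_eq_prodBernoulli_real W hp0 hp1 (h01 ht01 hg01),
    ← ED_eq_prodBernoulli_real W hp0 hp1 (h01 ht01 hf01)]
  ring

/-- **Sahi's inequality in `ED` form on every block of at most three coordinates** (kernel-checked cube theorem of the Sahi cell).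
[this work; from `SahiC3Cube.sahiC3_of_card_le_three`] -/
theorem ED_sahiE3_nonneg_of_card_le_three [DecidableEq ι] (W : Finset ι) (hW : W.card ≤ 3) {p : ι → ℝ}
    (hp0 : ∀ i, 0 ≤ p i) (hp1 : ∀ i, p i ≤ 1) {t f g : Finset ι → ℝ}
    (ht : ∀ ⦃S T : Finset ι⦄, S ⊆ T → t S ≤ t T) (ht01 : ∀ S, t S = 0 ∨ t S = 1)
    (hf : ∀ ⦃S T : Finset ι⦄, S ⊆ T → f S ≤ f T) (hf01 : ∀ S, f S = 0 ∨ f S = 1)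
    (hg : ∀ ⦃S T : Finset ι⦄, S ⊆ T → g S ≤ g T) (hg01 : ∀ S, g S = 0 ∨ g S = 1) :
    0 ≤ 2 * ED W p (fun S => t S * f S * g S) + ED W p t * ED W p f * ED W p g - ED W p t * ED W p (fun S => f S * g S)
        - ED W p f * ED W p (fun S => t S * g S) - ED W p g * ED W p (fun S => t S * f S) := by
  rw [ED_sahiE3_eq W hp0 hp1 ht01 hf01 hg01]
  have hcard : Fintype.card ↥W ≤ 3 := by rw [Fintype.card_coe]; exact hW
  exact SahiC3Cube.sahiC3_of_card_le_three hcard _ (isUpperSet_blockEvent W ht ht01) (isUpperSet_blockEvent W hf hf01)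
    (isUpperSet_blockEvent W hg hg01)

/-- **Sahi's `E₃ ≥ 0` whenever `A ∩ B` depends on at most three coordinates — unconditionally, in every dimension** (kernel
axioms only).  On the weighted cube `W ∪ D` (`W ∩ D = ∅`, `|W| ≤ 3`, `p ∈ [0,1]`), for monotone `{0,1}`-valued `u, f, g` with
`f(Z ∪ T)g(Z ∪ T) = f(D ∪ T)g(D ∪ T)` (`Z ⊆ D`, `T ⊆ W`): `E₃(u,f,g) ≥ 0`.  [this work] -/
theorem sahiE3_nonneg_of_mul_junta_card_le_three [DecidableEq ι] (W D : Finset ι) (hWD : Disjoint W D) (hW : W.card ≤ 3)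
    {p : ι → ℝ} (hp0 : ∀ i, 0 ≤ p i) (hp1 : ∀ i, p i ≤ 1) {u f g : Finset ι → ℝ}
    (hu : ∀ ⦃S T : Finset ι⦄, S ⊆ T → u S ≤ u T) (hu01 : ∀ S, u S = 0 ∨ u S = 1)
    (hf : ∀ ⦃S T : Finset ι⦄, S ⊆ T → f S ≤ f T) (hf01 : ∀ S, f S = 0 ∨ f S = 1)
    (hg : ∀ ⦃S T : Finset ι⦄, S ⊆ T → g S ≤ g T) (hg01 : ∀ S, g S = 0 ∨ g S = 1)
    (hfg : ∀ Z, Z ⊆ D → ∀ T, T ⊆ W → f (Z ∪ T) * g (Z ∪ T) = f (D ∪ T) * g (D ∪ T)) :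
    0 ≤ 2 * ED (W ∪ D) p (fun S => u S * f S * g S)
          + ED (W ∪ D) p u * ED (W ∪ D) p f * ED (W ∪ D) p g
          - ED (W ∪ D) p u * ED (W ∪ D) p (fun S => f S * g S)
          - ED (W ∪ D) p f * ED (W ∪ D) p (fun S => u S * g S)
          - ED (W ∪ D) p g * ED (W ∪ D) p (fun S => u S * f S) :=
  sahiE3_nonneg_of_mul_junta_of_block W D hWD hp0 hp1 hu hu01 hf hf01 hg hg01 hfg fun _ ht ht01 =>
    ED_sahiE3_nonneg_of_card_le_three W hW hp0 hp1 ht ht01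
      (fun _ _ hST => hf (Finset.union_subset_union (Finset.Subset.refl D) hST)) (fun _ => hf01 _)
      (fun _ _ hST => hg (Finset.union_subset_union (Finset.Subset.refl D) hST)) (fun _ => hg01 _)

end SahiE3JuntaMeet

end Summit.CriticalPhenomena.PercolationContinuityZ3.Theorems

end
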